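import Mathlib
import Summits.ValiantsHypothesis.ValiantsHypothesis.Theorems.FeketeSOSCharPSparseSOSStubCharSum211
import Summits.ValiantsHypothesis.ValiantsHypothesis.Theorems.FeketeSOSCharPSparseSOSSumCliquePolynomialMethod

/-!
# Crux `FeketeSOS.CharPSparseSOS` (stmt-ValiantsHypothesis-14989) — what COMPLETION gives on the
sum-clique core (CORE)

Every line on this crux reduces it (kernel-checked, `rQ_far_from_QR_of_charPSparseSOS`, p112874) to
(CORE): *a weak-Sidon Paley SUM-clique `Q ⊂ 𝔽_p` has `|Q| ≤ √p − p^δ/2 + O(1)`*.  Three classical tools bear on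
restricted sum-cliques (`a + b ∈ QR` for `a ≠ b`, the diagonal `2a` free):

* counting (weak-Sidon only): `|Q|(|Q| − 1)/2 ≤ (p − 1)/2`, i.e. `|Q| ≤ √p + 1/2`;
* Stepanov / Hanson–Petridis (tree: `Literature.Combinatorics.Additive.HansonPetridis`, and its exact reach on
  restricted sum-cliques, `sumClique_card_mul_card_good_le`: `|Q⁺| · |Q| ≤ (p − 1)/2` for the good-diagonal class);
* completion of the character sum `Σ_{a,b ∈ Q} χ(a + b)` ("Vinogradov", quoted as `|Q| ≤ √p + 2` in every memo of
  the crux, `Cruxes/CharPSparseSOS/NOTES.md` §I, §M) — which until now existed in this tree only on paper.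

This file kernel-checks the completion method in its sharp, identity form.  With
`Λ_Q(x) := Σ_{b ∈ Q} χ(x + b)` (`χ` the quadratic character of `𝔽_p`):

* `sum_sq_charTranslate_eq` — the ENERGY IDENTITY `Σ_x Λ_Q(x)² = |Q| (p − |Q|)` for every `Q ⊆ 𝔽_p`
  (Jacobsthal: `Σ_x χ((x + b)(x + b')) = −1` for `b ≠ b'`, `= p − 1` for `b = b'`);
* `sumClique_charTranslate_eq` — on a restricted sum-clique, `Λ_Q(a) = (|Q| − 1) + χ(2a)` for `a ∈ Q`;
* `sumClique_outsideEnergy_eq` — hence EXACTLY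
  `Σ_{x ∉ Q} Λ_Q(x)² = |Q| (p − |Q|) − Σ_{a ∈ Q} ((|Q| − 1) + χ(2a))²`;
* `sumClique_completion_bound` — dropping the outside energy: **`(|Q| − 2)² + |Q| ≤ p`** for EVERY restricted
  sum-clique (no Sidon hypothesis), i.e. `|Q| < √p + 3/2` (`sumClique_card_lt_sqrt_add`); with the diagonal
  resolved (`sumClique_completion_diag`): `|Q⁺| |Q|² + |Q⁻| (|Q| − 2)² ≤ |Q| (p − |Q|)`, so good diagonals push the
  completion bound to `|Q| ≤ √p − 1/2` and bad ones relax it to `√p + 3/2` — the same split as Hanson–Petridis,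
  one notch weaker on the good class, and the ONLY tool on the anti-diagonal class `Q⁻`.

READING for (CORE).  A counting-extremal clique (`|Q| = √p − c`) has outside energy
`Σ_{x ∉ Q} Λ_Q(x)² ≈ 2c·p`, against `≈ |Q|·p ≈ p^{3/2}` for a random `|Q|`-set: the translates `x + Q`, `x ∉ Q`,
must be almost perfectly colour-balanced in mean square.  (CORE) is EQUIVALENT, through
`sumClique_outsideEnergy_eq`, to the outside-energy lower bound `Σ_{x ∉ Q} Λ_Q(x)² ≥ |Q| · p^{1/2+δ}` for
near-extremal weak-Sidon sum-cliques — a (1 − p^{δ−1/2})-improvement of completion for a structured `√p`-set,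
i.e. Karatsuba's Conjecture-C range (crux NOTES §M): the residual problem Q.2 of the crux NOTES in one line.
-/

-- `Summit.ValiantsHypothesis.ValiantsHypothesis.…` is the tree's mandated single-conjunct layout (Sub = Summit).
set_option linter.dupNamespace false

namespace Summit.ValiantsHypothesis.ValiantsHypothesis.Theorems.CharPSparseSOSTwoCusp

open Finset
open Summit.ValiantsHypothesis.ValiantsHypothesis.Theorems.CharPSparseSOSTraceBias

/-! ## The energy identity `Σ_x Λ_Q(x)² = |Q| (p − |Q|)` -/

/-- `χ(y)² = [y ≠ 0]` for the quadratic character. -/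
theorem quadraticChar_sq_eq_ite {p : ℕ} [Fact p.Prime] (y : ZMod p) :
    quadraticChar (ZMod p) y ^ 2 = if y = 0 then 0 else 1 := by
  split_ifs with hy
  · rw [hy, quadraticChar_zero, sq, mul_zero]
  · exact quadraticChar_sq_one hy

/-- The diagonal term of the energy: `Σ_x χ(x + b)² = p − 1`. -/
theorem sum_quadraticChar_add_sq {p : ℕ} [Fact p.Prime] (b : ZMod p) :
    ∑ x : ZMod p, quadraticChar (ZMod p) (x + b) ^ 2 = (p : ℤ) - 1 := by
  have key : ∀ x : ZMod p,
      quadraticChar (ZMod p) (x + b) ^ 2 = 1 - if x = -b then 1 else 0 := by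
    intro x
    rw [quadraticChar_sq_eq_ite]
    by_cases hx : x = -b
    · rw [if_pos (by rw [hx]; exact neg_add_cancel b), if_pos hx]; ring
    · rw [if_neg (fun h => hx (eq_neg_of_add_eq_zero_left h)), if_neg hx]; ring
  rw [Finset.sum_congr rfl (fun x _ => key x), Finset.sum_sub_distrib, Finset.sum_const,
    Finset.card_univ, ZMod.card, Finset.sum_ite_eq' Finset.univ (-b) (fun _ => (1 : ℤ))]
  simp

/-- The off-diagonal/diagonal evaluation: `Σ_x χ(x + b) χ(x + b') = p − 1` if `b = b'`, `−1` otherwise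
(Jacobsthal), for an odd prime `p`. -/
theorem sum_quadraticChar_add_mul_add {p : ℕ} [Fact p.Prime] (hp2 : p ≠ 2) (b b' : ZMod p) :
    ∑ x : ZMod p, quadraticChar (ZMod p) (x + b) * quadraticChar (ZMod p) (x + b') =
      if b = b' then (p : ℤ) - 1 else -1 := by
  split_ifs with hbb
  · subst hbb
    rw [← sum_quadraticChar_add_sq b]
    exact Finset.sum_congr rfl fun x _ => by ring
  · rw [← cs_sum_quadraticChar_add_mul_add p hp2 hbb]
    exact Finset.sum_congr rfl fun x _ => by rw [← map_mul]

/-- **Energy identity.**  For an odd prime `p` and any `Q ⊆ 𝔽_p`, with `Λ_Q(x) = Σ_{b ∈ Q} χ(x + b)`: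
`Σ_x Λ_Q(x)² = |Q| · (p − |Q|)`.  (Expand the square and use `sum_quadraticChar_add_mul_add`.) -/
theorem sum_sq_charTranslate_eq :
    ∀ (p : ℕ) [Fact p.Prime], p ≠ 2 → ∀ Q : Finset (ZMod p),
      ∑ x : ZMod p, (∑ b ∈ Q, quadraticChar (ZMod p) (x + b)) ^ 2 =
        (Q.card : ℤ) * ((p : ℤ) - Q.card) := by
  intro p _ hp2 Q
  classical
  calc ∑ x : ZMod p, (∑ b ∈ Q, quadraticChar (ZMod p) (x + b)) ^ 2
      = ∑ x : ZMod p, ∑ b ∈ Q, ∑ b' ∈ Q,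
          quadraticChar (ZMod p) (x + b) * quadraticChar (ZMod p) (x + b') := by
        refine Finset.sum_congr rfl fun x _ => ?_
        rw [sq, Finset.sum_mul_sum]
    _ = ∑ b ∈ Q, ∑ b' ∈ Q, ∑ x : ZMod p,
          quadraticChar (ZMod p) (x + b) * quadraticChar (ZMod p) (x + b') := by
        rw [Finset.sum_comm]
        exact Finset.sum_congr rfl fun b _ => Finset.sum_comm
    _ = ∑ b ∈ Q, ∑ b' ∈ Q, (if b = b' then (p : ℤ) - 1 else -1) := by
        refine Finset.sum_congr rfl fun b _ => Finset.sum_congr rfl fun b' _ => ?_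
        exact sum_quadraticChar_add_mul_add hp2 b b'
    _ = ∑ b ∈ Q, ((p : ℤ) - Q.card) := by
        refine Finset.sum_congr rfl fun b hb => ?_
        have hsplit : ∀ b' : ZMod p,
            (if b = b' then (p : ℤ) - 1 else -1) = (if b = b' then (p : ℤ) else 0) - 1 := by
          intro b'; split_ifs <;> ring
        rw [Finset.sum_congr rfl (fun b' _ => hsplit b'), Finset.sum_sub_distrib, Finset.sum_ite_eq,
          if_pos hb, Finset.sum_const, nsmul_eq_mul, mul_one]
    _ = (Q.card : ℤ) * ((p : ℤ) - Q.card) := by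
        rw [Finset.sum_const, nsmul_eq_mul]

/-! ## Restricted sum-cliques: the diagonal values and the outside energy -/

/-- On a restricted sum-clique (`(a + b | p) = 1` for `a ≠ b` in `Q`), the translate sum at a point of the clique is
`Λ_Q(a) = (|Q| − 1) + χ(2a)`: every off-diagonal term is `1`, the diagonal is free. -/
theorem sumClique_charTranslate_eq {p : ℕ} [Fact p.Prime] (Q : Finset (ZMod p))
    (hclique : ∀ a ∈ Q, ∀ b ∈ Q, a ≠ b → legendreSym p (a + b).val = 1) {a : ZMod p} (ha : a ∈ Q) :
    ∑ b ∈ Q, quadraticChar (ZMod p) (a + b) = ((Q.card : ℤ) - 1) + quadraticChar (ZMod p) (a + a) := by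
  classical
  rw [← Finset.add_sum_erase Q _ ha]
  have hoff : ∀ b ∈ Q.erase a, quadraticChar (ZMod p) (a + b) = 1 := by
    intro b hb
    rw [Finset.mem_erase] at hb
    rw [← legendreSym_val_eq_quadraticChar]
    exact hclique a ha b hb.2 (Ne.symm hb.1)
  rw [Finset.sum_congr rfl hoff, Finset.sum_const, nsmul_eq_mul, mul_one,
    Finset.card_erase_of_mem ha, Nat.cast_sub (Finset.card_pos.mpr ⟨a, ha⟩), Nat.cast_one]
  ring

/-- **Outside energy of a restricted sum-clique, exactly.**  For an odd prime `p` and a restricted Paley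
sum-clique `Q ⊆ 𝔽_p`:
`Σ_{x ∉ Q} Λ_Q(x)² = |Q| (p − |Q|) − Σ_{a ∈ Q} ((|Q| − 1) + χ(2a))²`.
(CORE) for weak-Sidon sum-cliques is equivalent to a lower bound `≥ |Q| · p^{1/2+δ}` for the left-hand side when
`|Q| ≥ √p − p^δ`; the random level is `≈ |Q| · p`. -/
theorem sumClique_outsideEnergy_eq :
    ∀ (p : ℕ) [Fact p.Prime], p ≠ 2 → ∀ Q : Finset (ZMod p),
      (∀ a ∈ Q, ∀ b ∈ Q, a ≠ b → legendreSym p (a + b).val = 1) →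
      ∑ x ∈ Finset.univ \ Q, (∑ b ∈ Q, quadraticChar (ZMod p) (x + b)) ^ 2 =
        (Q.card : ℤ) * ((p : ℤ) - Q.card) -
          ∑ a ∈ Q, (((Q.card : ℤ) - 1) + quadraticChar (ZMod p) (a + a)) ^ 2 := by
  intro p _ hp2 Q hclique
  classical
  have htot := sum_sq_charTranslate_eq p hp2 Q
  rw [← Finset.sum_sdiff (Finset.subset_univ Q)] at htot
  have hin : ∑ a ∈ Q, (∑ b ∈ Q, quadraticChar (ZMod p) (a + b)) ^ 2 =
      ∑ a ∈ Q, (((Q.card : ℤ) - 1) + quadraticChar (ZMod p) (a + a)) ^ 2 :=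
    Finset.sum_congr rfl fun a ha => by rw [sumClique_charTranslate_eq Q hclique ha]
  rw [← hin]
  linarith

/-! ## The completion bound -/

/-- **Completion with the diagonal resolved.**  For an odd prime `p` and a restricted Paley sum-clique `Q ⊆ 𝔽_p`
with `|Q| ≥ 2`, `Q⁺ = {a ∈ Q : (2a|p) = 1}`:
`|Q⁺| · |Q|² + (|Q| − |Q⁺|) · (|Q| − 2)² ≤ |Q| · (p − |Q|)`
(a good diagonal contributes `Λ_Q(a)² = |Q|²`, a bad one at least `(|Q| − 2)²`, and the outside energy is `≥ 0`). -/
theorem sumClique_completion_diag :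
    ∀ (p : ℕ) [Fact p.Prime], p ≠ 2 → ∀ Q : Finset (ZMod p),
      (∀ a ∈ Q, ∀ b ∈ Q, a ≠ b → legendreSym p (a + b).val = 1) → 2 ≤ Q.card →
      ((Q.filter (fun a => legendreSym p (a + a).val = 1)).card : ℤ) * (Q.card : ℤ) ^ 2 +
          ((Q.card : ℤ) - (Q.filter (fun a => legendreSym p (a + a).val = 1)).card) * ((Q.card : ℤ) - 2) ^ 2 ≤
        (Q.card : ℤ) * ((p : ℤ) - Q.card) := by
  intro p _ hp2 Q hclique h2
  classical
  set G := Q.filter (fun a => legendreSym p (a + a).val = 1) with hG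
  have hout := sumClique_outsideEnergy_eq p hp2 Q hclique
  have hnonneg : 0 ≤ ∑ x ∈ Finset.univ \ Q, (∑ b ∈ Q, quadraticChar (ZMod p) (x + b)) ^ 2 :=
    Finset.sum_nonneg fun x _ => sq_nonneg _
  -- split the inside sum along the diagonal class
  have hsplit := (Finset.sum_filter_add_sum_filter_not Q (fun a => legendreSym p (a + a).val = 1)
    (fun a => (((Q.card : ℤ) - 1) + quadraticChar (ZMod p) (a + a)) ^ 2)).symm
  have hgood : ∑ a ∈ Q.filter (fun a => legendreSym p (a + a).val = 1),
      (((Q.card : ℤ) - 1) + quadraticChar (ZMod p) (a + a)) ^ 2 = (G.card : ℤ) * (Q.card : ℤ) ^ 2 := by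
    rw [hG]
    have : ∀ a ∈ Q.filter (fun a => legendreSym p (a + a).val = 1),
        (((Q.card : ℤ) - 1) + quadraticChar (ZMod p) (a + a)) ^ 2 = (Q.card : ℤ) ^ 2 := by
      intro a ha
      rw [Finset.mem_filter] at ha
      rw [← legendreSym_val_eq_quadraticChar, ha.2]
      ring
    rw [Finset.sum_congr rfl this, Finset.sum_const, nsmul_eq_mul]
  have hbad : ((Q.filter (fun a => ¬ legendreSym p (a + a).val = 1)).card : ℤ) * ((Q.card : ℤ) - 2) ^ 2 ≤
      ∑ a ∈ Q.filter (fun a => ¬ legendreSym p (a + a).val = 1),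
        (((Q.card : ℤ) - 1) + quadraticChar (ZMod p) (a + a)) ^ 2 := by
    have : ∀ a ∈ Q.filter (fun a => ¬ legendreSym p (a + a).val = 1),
        ((Q.card : ℤ) - 2) ^ 2 ≤ (((Q.card : ℤ) - 1) + quadraticChar (ZMod p) (a + a)) ^ 2 := by
      intro a _
      have hq2 : (2 : ℤ) ≤ Q.card := by exact_mod_cast h2
      have hχ : -1 ≤ quadraticChar (ZMod p) (a + a) := by
        rcases quadraticChar_isQuadratic (ZMod p) (a + a) with h | h | h <;> rw [h] <;> norm_num
      have h0 : 0 ≤ (Q.card : ℤ) - 2 := by linarith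
      exact pow_le_pow_left₀ h0 (by linarith) 2
    calc ((Q.filter (fun a => ¬ legendreSym p (a + a).val = 1)).card : ℤ) * ((Q.card : ℤ) - 2) ^ 2
        = ∑ a ∈ Q.filter (fun a => ¬ legendreSym p (a + a).val = 1), ((Q.card : ℤ) - 2) ^ 2 := by
          rw [Finset.sum_const, nsmul_eq_mul]
      _ ≤ _ := Finset.sum_le_sum this
  have hcardbad : ((Q.filter (fun a => ¬ legendreSym p (a + a).val = 1)).card : ℤ) =
      (Q.card : ℤ) - G.card := by
    have h := Finset.card_filter_add_card_filter_not
      (s := Q) (fun a => legendreSym p (a + a).val = 1)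
    rw [hG]
    have h' : ((Q.filter (fun a => legendreSym p (a + a).val = 1)).card : ℤ) +
        ((Q.filter (fun a => ¬ legendreSym p (a + a).val = 1)).card : ℤ) = Q.card := by
      exact_mod_cast h
    linarith
  rw [hcardbad] at hbad
  rw [hsplit, hgood] at hout
  linarith

/-- **The completion bound for restricted Paley sum-cliques ("Vinogradov"), kernel-checked.**  For an odd prime
`p` and `Q ⊆ 𝔽_p` with `(a + b | p) = 1` for all `a ≠ b` in `Q` (diagonal free, NO Sidon hypothesis):
`(|Q| − 2)² + |Q| ≤ p`, i.e. `|Q|² − 3|Q| + 4 ≤ p` (for `|Q| ≥ 2`; trivially for `|Q| ≤ 1`).  Tight at `p = 13`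
(`Q = {0, 1, 3, 9}`).  This is the exact reach of completion on (CORE); (CORE) asks for `|Q| ≤ √p − p^δ/2 + O(1)`. -/
theorem sumClique_completion_bound :
    ∀ (p : ℕ) [Fact p.Prime], p ≠ 2 → ∀ Q : Finset (ZMod p),
      (∀ a ∈ Q, ∀ b ∈ Q, a ≠ b → legendreSym p (a + b).val = 1) →
      (Q.card - 2) ^ 2 + Q.card ≤ p := by
  intro p hp hp2 Q hclique
  classical
  by_cases h2 : 2 ≤ Q.card
  · have h := sumClique_completion_diag p hp2 Q hclique h2
    set G := Q.filter (fun a => legendreSym p (a + a).val = 1) with hG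
    have hGle : G.card ≤ Q.card := Finset.card_filter_le _ _
    have hGleZ : (G.card : ℤ) ≤ Q.card := by exact_mod_cast hGle
    have hq2 : (2 : ℤ) ≤ Q.card := by exact_mod_cast h2
    -- each good point contributes |Q|² ≥ (|Q| − 2)², so |Q| (|Q| − 2)² ≤ |Q| (p − |Q|)
    have hsq : ((Q.card : ℤ) - 2) ^ 2 ≤ (Q.card : ℤ) ^ 2 := by nlinarith
    have hmain : (Q.card : ℤ) * ((Q.card : ℤ) - 2) ^ 2 ≤ (Q.card : ℤ) * ((p : ℤ) - Q.card) := by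
      have hG0 : (0 : ℤ) ≤ G.card := by exact_mod_cast Nat.zero_le _
      nlinarith
    have hqpos : (0 : ℤ) < Q.card := by linarith
    have hdiv : ((Q.card : ℤ) - 2) ^ 2 ≤ (p : ℤ) - Q.card := le_of_mul_le_mul_left hmain hqpos
    have hcast : (((Q.card - 2) ^ 2 + Q.card : ℕ) : ℤ) ≤ (p : ℤ) := by
      push_cast [Nat.cast_sub h2]
      linarith
    exact_mod_cast hcast
  · push Not at h2
    have hsub : Q.card - 2 = 0 := by omega
    rw [hsub]
    have := hp.out.two_le
    omega

/-- **`|Q| < √p + 3/2` for every restricted Paley sum-clique** (real form of `sumClique_completion_bound`: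
`(|Q| − 3/2)² ≤ p − 7/4 < p`). -/
theorem sumClique_card_lt_sqrt_add {p : ℕ} [hp : Fact p.Prime] (hp2 : p ≠ 2) (Q : Finset (ZMod p))
    (hclique : ∀ a ∈ Q, ∀ b ∈ Q, a ≠ b → legendreSym p (a + b).val = 1) :
    (Q.card : ℝ) < Real.sqrt p + 3 / 2 := by
  have h := sumClique_completion_bound p hp2 Q hclique
  set q := Q.card with hq
  have hreal : ((q : ℝ) - 2) ^ 2 + q ≤ p ∨ q ≤ 1 := by
    by_cases h2 : 2 ≤ q
    · left
      have : (((q - 2) ^ 2 + q : ℕ) : ℝ) ≤ (p : ℝ) := by exact_mod_cast h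
      push_cast [Nat.cast_sub h2] at this
      exact this
    · right; omega
  have hp0 : (0 : ℝ) ≤ Real.sqrt p := Real.sqrt_nonneg _
  rcases hreal with hreal | hsmall
  · by_contra hcon
    push Not at hcon
    -- √p ≤ q − 3/2, square both sides
    have h1 : Real.sqrt p ≤ (q : ℝ) - 3 / 2 := by linarith
    have h2 : (Real.sqrt p) ^ 2 ≤ ((q : ℝ) - 3 / 2) ^ 2 := pow_le_pow_left₀ hp0 h1 2
    rw [Real.sq_sqrt (Nat.cast_nonneg p)] at h2
    nlinarith
  · have hq1 : (q : ℝ) ≤ 1 := by exact_mod_cast hsmall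
    have hp1 : (1 : ℝ) ≤ Real.sqrt p := by
      rw [show (1 : ℝ) = Real.sqrt 1 from Real.sqrt_one.symm]
      exact Real.sqrt_le_sqrt (by exact_mod_cast hp.out.one_le)
    linarith

end Summit.ValiantsHypothesis.ValiantsHypothesis.Theorems.CharPSparseSOSTwoCusp
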